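import Literature.MathematicalPhysics.QuantumFieldTheory.Balaban1983to89.B5Hk163Alias
import Literature.MathematicalPhysics.QuantumFieldTheory.Balaban1983to89.B4TorusKernel

/-!
# `Balaban1983to89.B5Hk163Decay` — STRIP REGULARITY of the fine-offset multipliers of the (1.63) operator `H_k` and the exponential decay of their lattice / torus kernels (cell node X10, GAPS G-b05g10-3; successor of `B5Hk163Strip`, `B5Hk163Alias`)

T. Bałaban, *Propagators and renormalization transformations for lattice gauge theories. I*, Commun. Math.
Phys. **95**, 17–40 (1984) [`Balaban1984PropagatorsI`, cell paper B5].  PRINTED TEXT (locations only; renders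
`…rt-I-p012-x2.png`, `…-p013-x2.png`, `…-p022-x2.png` read as images by the author of this file): (1.63) p. 28
[PDF 12] — the momentum representation `(H_kB)_μ(x′) = Σ_λ (2π)^{−d} ∫dp′ Σ_l e^{i(p′+l)x′}[…](B̃)_λ(p′)`, whose
bracket (second printed expression) is `B5Symbol163.second163` and, on the zero-free strip, `Σ_λ h163 μ λ l (p′)·B̃_λ`
(`B5Hk163Strip.second163_eq_sum_h163`); p. 29 [PDF 13]: «We will need also a representation of H_k similar to the
representation (1.44) of the projection R. It will be expressed in terms of well-defined bounded operators.»; and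
the METHOD, p. 38 [PDF 22], verbatim: «They follow from the representation P = G′Q′*(Q′G′²Q′*)⁻¹Q′G′, from Lemma 2.4
of [2], and the representation (1.45) and the analyticity method of proving an exponential decay (see the proof of
Lemma 2.4 in [2]).»  B5 prints NO display asserting an exponential decay of the kernel of (1.63) on pp. 28–29; what
is proved below is an AUDIT CONSTRUCTION in the style of the p. 38 method, `[folklore]` throughout; the `[cite: …]`
tags are TEXT LOCATIONS only — nothing printed enters as a hypothesis (ABSOLUTE RULE).

## Content (sorry-free)

Fix `n = L^k ≥ 1`, directions `μ, λ`, and a FINE OFFSET `a ∈ {0,…,n−1}^d` (the position `ηa`, `η = 1/n`, of a fine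
lattice point `x′ = y′ + ηa` inside its unit cell, `y′ ∈ ℤ^d`).  Since `l ∈ 2πℤ^d`, `e^{i(p′+l)·x′} = e^{ip′·y′}·e^{i(p′+l)·ηa}`
(`exp_fine_phase_split`), so the (1.63) kernel between the fine point `y′ + ηa` and the coarse point `y` is the
ordinary `ℤ^d`-Fourier kernel, at `y′ − y`, of the COARSE multiplier
`G_a(p′) := Σ_{l ∈ 2π{0,…,n−1}^d} e^{i(p′+l)·ηa} · h_{l;μλ}(p′)`  (`G163 n μ λ a p′`, §1, phase `phase163`).
* §1 `phase163`, `G163`; the phase is a product of powers of `e^{iη(p′_ν+l_ν)} = (B4StripSums.w)⁻¹`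
  (`B5Hk163Alias.exp_shift_eq_inv_w`), of modulus `≤ e^κ` per coordinate on the strip (`norm_exp_shift_pow_le`,
  because `a_ν/n ≤ 1`), entire, and ALIAS-COVARIANT across the strip sides: `phase163 l a (p′+2πe_ν) = phase163 (σ_ν l) a p′`
  (`phase163_tr` — the integrality of `a` is what makes the `2πn`-ambiguity of `σ_ν` invisible);
* §2 `G163_tr`: `G_a(p′ + 2πe_ν) = G_a(p′)` at the side points `Re p′_ν = −π` of `Strip d κ`, `κ ≤ κ₁₆₃(d)` — from
  `B5Hk163Alias.h163_tr` (the alias family is PERMUTED by `σ_ν`) and `phase163_tr`, re-summed with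
  `B5Strip145Analytic.sigmaEquiv`; `norm_G163_le`: `‖G_a(p′)‖ ≤ (e^κ)^d · Msum163 d` (`B5Hk163Alias.sum_norm_h163_le`);
  `differentiableAt_G163` (from `B5Hk163Strip.differentiableAt_h163`);
* §3 **`stripRegular_G163`**: `B4ContourShift.StripRegular (G163 n μ λ a) κ (MG163 (d+1))` on `Strip (d+1) κ` for EVERY
  `n ≥ 1`, `μ`, `λ`, `a` and `0 ≤ κ ≤ κ₁₆₃(d+1)` — constants depending on the dimension only; and the corollaries BY
  NAME of the b04 engine: `latticeKernel_G163_decay` (`‖K_a(x)‖ ≤ MG163·e^{−κ₁₆₃|x|_∞}` on `ℤ^{d+1}`,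
  `B4ContourShift.latticeKernel_decay`) and `torusKernel_G163_decay` (every period vector `N`, all `N_i ≥ 1`:
  `‖K_{a,N}(x)‖ ≤ MG163 · periodConst · e^{−(κ₁₆₃/(d+1))|x|_{T,∞}}`, `B4TorusKernel.MultiPeriod.torusKernel_descend_decay_torusMetric`),
  uniformly in `n` and `a`;
* §4 the DICTIONARY lemma `exp_fine_phase_split`:
  `e^{i Σ_ν (p′_ν+l_ν)(y_ν + a_ν/n)} = e^{i Σ_ν p′_ν y_ν} · phase163 l a p′` for `y ∈ ℤ^d` (so the `l`-sum of (1.63) at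
  the fine point `y + ηa` is `e^{ip′·y} G_a(p′)` applied to `B̃`).

## Honest scope

(i) The identification of `latticeKernel (G163 n μ λ a) (y′ − y)` (resp. the torus kernel) with «the kernel of
`H_k` between `y′ + ηa` and `y`» for a TYPED lattice operator `H_k` is Fourier-inversion bookkeeping left to the
consumer that types `H_k` (cell lanes t4-ne2 / node X10), exactly as `B5Kernel166Decay` §1 did it for `deltaPol`;
this module supplies the analytic input (`StripRegular`, d-only constants, uniform in `n`, `a`) and §4.
(ii) `strip_interpolation` with real `η`-rates (GAPS G-ne2p2-6 (iii), second half) is not touched.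
(iii) Constants (`MG163`, `κ₁₆₃`) are crude, ours, `d`-only — never Bałaban's `O(1)`, `δ₀`; `U = 1`, `m² = 0` as in
the whole b05 lineage.  Value = kernel certificate, NOT summit progress, NOT continuum, NOT Clay.
-/

open scoped BigOperators Real
open Finset Complex

namespace Literature.MathematicalPhysics.QuantumFieldTheory.Balaban1983to89.B5Hk163Decay

open Literature.MathematicalPhysics.QuantumFieldTheory.Balaban1983to89.B4Strip
open Literature.MathematicalPhysics.QuantumFieldTheory.Balaban1983to89.B4StripCauchy
open Literature.MathematicalPhysics.QuantumFieldTheory.Balaban1983to89.B4ContourShift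
open Literature.MathematicalPhysics.QuantumFieldTheory.Balaban1983to89.B4TorusKernel (descendC periodConst)
open Literature.MathematicalPhysics.QuantumFieldTheory.Balaban1983to89.B4TorusKernel.MultiPeriod (torusKernel
  torusSupNorm torusKernel_descend_decay_torusMetric)
open Literature.MathematicalPhysics.QuantumFieldTheory.Balaban1983to89.B5Strip145Analytic
open Literature.MathematicalPhysics.QuantumFieldTheory.Balaban1983to89.B5Strip145Decay (differentiableAt_insertNth
  tr_insertNth_left insertNth_left_mem)
open Literature.MathematicalPhysics.QuantumFieldTheory.Balaban1983to89.B5Symbol166Strip (kappa166_le_rOf)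
open Literature.MathematicalPhysics.QuantumFieldTheory.Balaban1983to89.B5Hk163Strip
open Literature.MathematicalPhysics.QuantumFieldTheory.Balaban1983to89.B5Hk163Alias
open Literature.MathematicalPhysics.QuantumFieldTheory.Balaban1983to89.B4StripSums (w w_add_two_pi tr_mem_Strip)

noncomputable section

variable {d : ℕ}

/-! ## §1. The fine-offset phase and the coarse multipliers `G_a` -/

section Phase

variable (n : ℕ) [NeZero n]

/-- the FINE-OFFSET PHASE `e^{i(p′+l)·ηa} = Π_ν (e^{iη(p′_ν + l_ν)})^{a_ν}`, `l = 2πk`, `a ∈ {0,…,n−1}^d`, `η = 1/n`.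
[cite: Balaban1984PropagatorsI, (1.63) p.28, the factor e^{i(p′+l)x′}] [folklore] -/
def phase163 (k a : Fin d → Fin n) (p : Fin d → ℂ) : ℂ :=
  ∏ ν, Complex.exp (shift n k p ν / n * I) ^ (a ν : ℕ)

/-- THE COARSE MULTIPLIER OF FINE OFFSET `a`: `G_a(p′) = Σ_{l ∈ 2π{0,…,n−1}^d} e^{i(p′+l)·ηa} h_{l;μλ}(p′)`. [folklore] -/
def G163 (μ lam : Fin d) (a : Fin d → Fin n) (p : Fin d → ℂ) : ℂ :=
  ∑ k : Fin d → Fin n, phase163 n k a p * h163 n μ lam k p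

/-- one phase factor has modulus `e^{−Im p′_ν · a_ν/n} ≤ e^κ` on the strip (`a_ν < n`). [folklore] -/
theorem norm_exp_shift_pow_le {κ : ℝ} {p : Fin d → ℂ} (hp : p ∈ Strip d κ) (k : Fin d → Fin n) (ν : Fin d)
    (a : Fin n) : ‖Complex.exp (shift n k p ν / n * I) ^ (a : ℕ)‖ ≤ Real.exp κ := by
  have hn : (0 : ℝ) < n := Nat.cast_pos.mpr (Nat.pos_of_ne_zero (NeZero.ne n))
  have him : |(p ν).im| ≤ κ := (hp ν).2
  rw [norm_pow, Complex.norm_exp, ← Real.exp_nat_mul]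
  apply Real.exp_le_exp.mpr
  have hre : (shift n k p ν / n * I).re = -((p ν).im / n) := by
    rw [Complex.mul_I_re, Complex.div_natCast_im, shift_im]
  rw [hre]
  have ha : ((a : ℕ) : ℝ) / n ≤ 1 := by
    rw [div_le_one hn]; exact_mod_cast a.isLt.le
  have ha0 : 0 ≤ ((a : ℕ) : ℝ) / n := by positivity
  calc ((a : ℕ) : ℝ) * -((p ν).im / n) = (((a : ℕ) : ℝ) / n) * (-(p ν).im) := by ring
    _ ≤ (((a : ℕ) : ℝ) / n) * |(p ν).im| := by gcongr; exact neg_le_abs _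
    _ ≤ 1 * κ := mul_le_mul ha him (abs_nonneg _) zero_le_one
    _ = κ := one_mul κ

/-- `‖phase163 l a p′‖ ≤ (e^κ)^d` on the strip. [folklore] -/
theorem norm_phase163_le {κ : ℝ} {p : Fin d → ℂ} (hp : p ∈ Strip d κ) (k a : Fin d → Fin n) :
    ‖phase163 n k a p‖ ≤ Real.exp κ ^ d := by
  unfold phase163
  rw [norm_prod]
  calc ∏ ν, ‖Complex.exp (shift n k p ν / n * I) ^ (a ν : ℕ)‖ ≤ ∏ _ν : Fin d, Real.exp κ :=
        Finset.prod_le_prod (fun ν _ => norm_nonneg _) (fun ν _ => norm_exp_shift_pow_le n hp k ν (a ν))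
    _ = Real.exp κ ^ d := by rw [Finset.prod_const, Finset.card_univ, Fintype.card_fin]

omit [NeZero n] in
/-- the phase is entire. [folklore] -/
theorem differentiable_phase163 (k a : Fin d → Fin n) :
    Differentiable ℂ (fun p : Fin d → ℂ => phase163 n k a p) := by
  intro q
  unfold phase163
  exact dAt_finset_prod _ _ q (fun ν _ => ((differentiable_shiftPhase n k ν) q).cexp.pow _)

/-- the coordinate phase factor is ALIAS-COVARIANT: `e^{iη((p′+2πe_ν)_μ + l_μ)} = e^{iη(p′_μ + (σ_ν l)_μ)}` (the two
exponents differ by `2πi` times an integer). [folklore] -/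
theorem exp_shift_tr (k : Fin d → Fin n) (p : Fin d → ℂ) (ν μ : Fin d) :
    Complex.exp (shift n k (tr p ν) μ / n * I) = Complex.exp (shift n (sigma n ν k) p μ / n * I) := by
  have hn : (n : ℂ) ≠ 0 := Nat.cast_ne_zero.mpr (NeZero.ne n)
  have h := dC_tr n k p ν μ
  unfold dC at h
  exact sub_left_inj.mp (mul_left_cancel₀ hn h)

/-- `phase163 l a (p′ + 2πe_ν) = phase163 (σ_ν l) a p′`. [folklore] -/
theorem phase163_tr (k a : Fin d → Fin n) (p : Fin d → ℂ) (ν : Fin d) :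
    phase163 n k a (tr p ν) = phase163 n (sigma n ν k) a p := by
  unfold phase163
  exact Finset.prod_congr rfl (fun μ _ => by rw [exp_shift_tr])

end Phase

/-! ## §2. Side periodicity, bound and holomorphy of `G_a` -/

section Ga

variable (n : ℕ) [NeZero n]

/-- **SIDE PERIODICITY**: at a side point `Re p′_ν = −π` of the strip, `G_a(p′ + 2πe_ν) = G_a(p′)` — the alias
family is permuted by `σ_ν` (`B5Hk163Alias.h163_tr`) and the phase is `σ_ν`-covariant (`phase163_tr`). [folklore] -/
theorem G163_tr {κ : ℝ} (hκ0 : 0 ≤ κ) (hκ : κ ≤ kappa163 d) {p : Fin d → ℂ} (hp : p ∈ Strip d κ) (ν : Fin d)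
    (hre : (p ν).re = -Real.pi) (μ lam : Fin d) (a : Fin d → Fin n) :
    G163 n μ lam a (tr p ν) = G163 n μ lam a p := by
  unfold G163
  have h : ∀ k : Fin d → Fin n, phase163 n k a (tr p ν) * h163 n μ lam k (tr p ν) =
      phase163 n (sigma n ν k) a p * h163 n μ lam (sigma n ν k) p := fun k => by
    rw [phase163_tr, h163_tr n hκ0 hκ hp ν hre μ lam k]
  simp_rw [h]
  exact Equiv.sum_comp (sigmaEquiv n ν) (fun k => phase163 n k a p * h163 n μ lam k p)

/-- `0 ≤ Msum163 d`. [folklore] -/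
theorem Msum163_nonneg (d : ℕ) : 0 ≤ Msum163 d := by
  unfold Msum163
  have h1 := Shead163_nonneg d
  have h2 := Stail163_nonneg d
  have h3 := Mg163_nonneg d
  positivity

/-- **THE STRIP BOUND** `‖G_a(p′)‖ ≤ (e^κ)^d · Msum163 d`, uniformly in `n` and `a`. [folklore] -/
theorem norm_G163_le {κ : ℝ} (hκ0 : 0 ≤ κ) (hκ : κ ≤ kappa163 d) {p : Fin d → ℂ} (hp : p ∈ Strip d κ)
    (μ lam : Fin d) (a : Fin d → Fin n) : ‖G163 n μ lam a p‖ ≤ Real.exp κ ^ d * Msum163 d := by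
  unfold G163
  calc ‖∑ k : Fin d → Fin n, phase163 n k a p * h163 n μ lam k p‖
      ≤ ∑ k : Fin d → Fin n, ‖phase163 n k a p * h163 n μ lam k p‖ := norm_sum_le _ _
    _ ≤ ∑ k : Fin d → Fin n, Real.exp κ ^ d * ‖h163 n μ lam k p‖ := by
        refine Finset.sum_le_sum (fun k _ => ?_)
        rw [norm_mul]
        exact mul_le_mul_of_nonneg_right (norm_phase163_le n hp k a) (norm_nonneg _)
    _ = Real.exp κ ^ d * ∑ k : Fin d → Fin n, ‖h163 n μ lam k p‖ := by rw [Finset.mul_sum]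
    _ ≤ Real.exp κ ^ d * Msum163 d :=
        mul_le_mul_of_nonneg_left (sum_norm_h163_le n hκ0 hκ hp μ lam) (by positivity)

/-- **HOLOMORPHY**: `G_a` is (jointly) holomorphic at every point of the zero-free strip. [folklore] -/
theorem differentiableAt_G163 {κ : ℝ} (hκ0 : 0 ≤ κ) (hκ : κ ≤ kappa163 d) {p : Fin d → ℂ}
    (hp : p ∈ Strip d κ) (μ lam : Fin d) (a : Fin d → Fin n) :
    DifferentiableAt ℂ (fun q : Fin d → ℂ => G163 n μ lam a q) p := by
  unfold G163
  exact DifferentiableAt.fun_sum (fun k _ =>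
    ((differentiable_phase163 n k a) p).mul (differentiableAt_h163 n hκ0 hκ hp μ lam k))

end Ga

/-! ## §3. Strip regularity (dimension `d + 1`) and the kernel decay corollaries -/

section Regular

/-- the explicit `d`-only strip bound `(e¹)^d · Msum163 d` (uses `κ ≤ κ₁₆₃ ≤ 1`). [folklore] -/
def MG163 (d : ℕ) : ℝ := Real.exp 1 ^ d * Msum163 d

/-- `0 ≤ MG163 d`. [folklore] -/
theorem MG163_nonneg (d : ℕ) : 0 ≤ MG163 d := by
  unfold MG163; have := Msum163_nonneg d; positivity

/-- **STRIP REGULARITY OF THE FINE-OFFSET MULTIPLIERS** on `ℂ^{d+1}`: for EVERY `n ≥ 1`, `μ`, `λ`, fine offset `a`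
and `0 ≤ κ ≤ κ₁₆₃(d+1)`, `G163 n μ λ a` is continuous on the closed strip, holomorphic in every coordinate slice,
takes equal values on the vertical sides, and is bounded by `MG163 (d+1)`. [folklore] -/
theorem stripRegular_G163 (n : ℕ) [NeZero n] {κ : ℝ} (hκ0 : 0 ≤ κ) (hκ : κ ≤ kappa163 (d + 1))
    (μ lam : Fin (d + 1)) (a : Fin (d + 1) → Fin n) :
    StripRegular (d := d) (fun p : Fin (d + 1) → ℂ => G163 n μ lam a p) κ (MG163 (d + 1)) := by
  have hκ1 : κ ≤ 1 := (kappa_small hκ0 (hκ.trans (kappa163_le_rOf _))).1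
  have hdiffAt : ∀ p ∈ Strip (d + 1) κ, DifferentiableAt ℂ (fun q : Fin (d + 1) → ℂ => G163 n μ lam a q) p :=
    fun p hp => differentiableAt_G163 n hκ0 hκ hp μ lam a
  refine ⟨?_, ?_, ?_, ?_⟩
  · exact fun p hp => (hdiffAt p hp).continuousAt.continuousWithinAt
  · intro i q hq z hz
    have hP : i.insertNth z (ofRealVec q) ∈ Strip (d + 1) κ :=
      insertNth_mem_Strip hκ0 i hq (openRect_subset_closedRect κ hz)
    exact ((hdiffAt _ hP).comp z (differentiableAt_insertNth i _ z)).differentiableWithinAt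
  · intro i q hq y hy
    obtain ⟨hP, hre⟩ := insertNth_left_mem hκ0 i hq hy
    show G163 n μ lam a _ = G163 n μ lam a _
    rw [← tr_insertNth_left]
    exact (G163_tr n hκ0 hκ hP i hre μ lam a).symm
  · intro p hp
    refine (norm_G163_le n hκ0 hκ hp μ lam a).trans ?_
    unfold MG163
    have hM := Msum163_nonneg (d + 1)
    have he : Real.exp κ ^ (d + 1) ≤ Real.exp 1 ^ (d + 1) :=
      pow_le_pow_left₀ (Real.exp_pos κ).le (Real.exp_le_exp.mpr hκ1) _
    exact mul_le_mul_of_nonneg_right he hM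

/-- **EXPONENTIAL DECAY OF THE INFINITE-LATTICE KERNEL** of `G_a` (`B4ContourShift.latticeKernel_decay` by name):
`‖K_a(x)‖ ≤ MG163(d+1) · e^{−κ₁₆₃(d+1)·|x|_∞}` for every `x ∈ ℤ^{d+1}`, `n ≥ 1`, `μ`, `λ`, `a`. [folklore] -/
theorem latticeKernel_G163_decay (n : ℕ) [NeZero n] (μ lam : Fin (d + 1)) (a : Fin (d + 1) → Fin n)
    (x : Fin (d + 1) → ℤ) :
    ‖latticeKernel (fun p : Fin (d + 1) → ℂ => G163 n μ lam a p) x‖ ≤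
      MG163 (d + 1) * Real.exp (-(kappa163 (d + 1) * supNorm x)) :=
  latticeKernel_decay (stripRegular_G163 n (kappa163_pos _).le le_rfl μ lam a) (kappa163_pos _).le x

/-- **EXPONENTIAL DECAY OF THE TORUS KERNELS** of `G_a` (`B4TorusKernel.MultiPeriod.torusKernel_descend_decay_torusMetric`
by name): for every period vector `N` (all `N_i ≥ 1`), `n ≥ 1`, `μ`, `λ`, `a`, `x`:
`‖K_{a,N}(x)‖ ≤ MG163(d+1) · periodConst(κ₁₆₃(d+1), d) · e^{−(κ₁₆₃(d+1)/(d+1))·|x|_{T,∞}}`. [folklore] -/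
theorem torusKernel_G163_decay (n : ℕ) [NeZero n] (μ lam : Fin (d + 1)) (a : Fin (d + 1) → Fin n)
    {N : Fin (d + 1) → ℕ} (hN : ∀ i, 1 ≤ N i) (x : Fin (d + 1) → ℤ) :
    ‖torusKernel (descendC (fun p : Fin (d + 1) → ℂ => G163 n μ lam a p)
        (stripRegular_G163 n (kappa163_pos _).le le_rfl μ lam a) (kappa163_pos _).le) N x‖ ≤
      MG163 (d + 1) * periodConst (kappa163 (d + 1)) d *
        Real.exp (-(kappa163 (d + 1) / (d + 1) * torusSupNorm N x)) :=
  torusKernel_descend_decay_torusMetric _ (kappa163_pos _) hN x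

end Regular

/-! ## §4. The dictionary: fine point = coarse point + fine offset -/

section Dictionary

variable (n : ℕ)

/-- ONE COORDINATE: `e^{i(p′+l)(y + a/n)} = e^{ip′y} · (e^{iη(p′+l)})^a` for `y ∈ ℤ`, `a ∈ ℕ`, `l = 2πk` (the alias
phase `e^{ily} = 1` drops out). [folklore] -/
theorem exp_shift_coord_split (k : Fin d → Fin n) (p : Fin d → ℂ) (ν : Fin d) (y : ℤ) (a : ℕ) :
    Complex.exp (shift n k p ν * ((y : ℂ) + (a : ℂ) / n) * I) =
      Complex.exp (p ν * y * I) * Complex.exp (shift n k p ν / n * I) ^ a := by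
  have h1 : Complex.exp ((((k ν : ℕ) : ℤ) * y : ℤ) * (2 * π * I)) = 1 := Complex.exp_int_mul_two_pi_mul_I _
  rw [← Complex.exp_nat_mul, ← mul_one (Complex.exp (p ν * y * I)), ← h1, ← Complex.exp_add, ← Complex.exp_add]
  congr 1
  simp only [shift]
  push_cast
  ring

/-- **THE FINE-POINT PHASE SPLITS**: `e^{i Σ_ν (p′_ν + l_ν)(y_ν + a_ν/n)} = e^{i Σ_ν p′_ν y_ν} · phase163 l a p′` for
`y ∈ ℤ^d`, `a ∈ {0,…,n−1}^d` — so the `l`-sum of (1.63) at the fine point `x′ = y + ηa` is `e^{ip′·y}·G_a(p′)` applied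
to `B̃(p′)`, and the kernel of `H_k` from the coarse point `y₀` to `y + ηa` is the `ℤ^d`-Fourier kernel of `G_a` at
`y − y₀`. [cite: Balaban1984PropagatorsI, (1.63) p.28] [folklore] -/
theorem exp_fine_phase_split [NeZero n] (k a : Fin d → Fin n) (p : Fin d → ℂ) (y : Fin d → ℤ) :
    Complex.exp ((∑ ν, shift n k p ν * ((y ν : ℂ) + ((a ν : ℕ) : ℂ) / n)) * I) =
      Complex.exp ((∑ ν, p ν * (y ν : ℂ)) * I) * phase163 n k a p := by
  unfold phase163
  rw [Finset.sum_mul, Complex.exp_sum, Finset.sum_mul, Complex.exp_sum, ← Finset.prod_mul_distrib]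
  exact Finset.prod_congr rfl (fun ν _ => by rw [exp_shift_coord_split])

end Dictionary

end

end Literature.MathematicalPhysics.QuantumFieldTheory.Balaban1983to89.B5Hk163Decay
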